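import Literature.Analysis.FluidPDE.BarkerPrangeConcentrationProofs
import Literature.Analysis.FluidPDE.LerayHopfRegularRestart
import HarnessLib

/-!
# Barker–Prange 2020, Theorem 2: reduction to a compactness statement for local energy solutions

Analysis/FluidPDE proof file (theorems only: no definitions, no named facts — D-0026) below the
named fact `Literature.Analysis.FluidPDE.BarkerPrange2020_thm2` (`BarkerPrangeConcentration.lean`;
T. Barker, C. Prange, Arch. Ration. Mech. Anal. 236 (2020) = arXiv:1812.09115, **Theorem 2**:
`L³` concentration at the similarity scale near a Type-I singularity of a Leray–Hopf solution
first blowing up at `T`).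

## Why this file deviates from the printed proof

The printed proof of Theorem 2 (§4.2, p. 16) is a rescaling argument reducing it to the paper's
main result, Theorem 1 (localized smoothing for local energy solutions with locally critical
data); that reduction is already a theorem of the tree (`BarkerPrange2020_thm2_of_thm1`,
`BarkerPrangeConcentrationOfThm1.lean`). Theorem 1 itself (§§2–4.1: a Caffarelli–Kohn–Nirenberg
iteration for the critically perturbed system, a bootstrap on Oseen potentials, Kato's `L⁵`
theory) is a theory absent from the tree. The transcribed statement `BarkerPrange2020_thm2`
asserts the EXISTENCE of the constants `γ` and `S = S(M)` (it does not pin them to those of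
Theorem 1), and for that statement there is a second, softer road through results the tree
already PROVES — Seregin's limiting procedure for local energy solutions
(`seregin2014_localEnergy_limitingProcedure_holds`), the decay of local energy solutions
(`seregin2014_limit_decay_holds`), Lemarié-Rieusset's stability of singular points
(`lemarieRieusset_singular_point_stability_holds`), the a priori estimate
(`apriori_unit_scale_slab`) and the `ε`-regularity criterion
(`lemarieRieusset_epsilon_regularity_holds`): if, for a fixed universal `γ` and a fixed `M`, NO
`S` works, then violators for `S_n → 0` rescale (exactly as in §4.2, `λ² = ν(T - t)/σ`) to
unit-viscosity local energy solutions `v_n` on a fixed strip `ℝ³ × (0, σ)`, `σ = σ(M)`, all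
singular at `(σ, 0)`, with data bounded by `M` in `L²_uloc` (the Type-I bound at radius `λ`) and
`γ`-small in `L³(B(0, R_n))`, `R_n = 2√(σ/S_n) → ∞`; a subsequence converges to a local energy
solution whose datum is `γ`-small in `L³(ℝ³)` (the far field has gone to infinity), which is
regular at `(σ, 0)` — contradicting the stability of singular points. This file proves the
**rescaling half** of that argument:

* `BarkerPrange2020.exists_rescaled_of_small_L3` — one violator, rescaled: given a global
  Leray–Hopf solution `u` with the Type-I bound `(M, r₀)`, regular on the open strip `(0, T)`,
  singular at `(T, x₀)`, a time `t ∈ (0, T)` with `T - S r₀²/ν < t` (when `r₀ < ∞`) at which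
  `‖u(t)‖_{L³(B̄(x₀, 2√(ν(T-t)/S)))} ≤ γ ν`, and `0 < S ≤ σ < 1`: the field
  `v(s, y) = (λ/ν) u(t + λ² s/ν, x₀ + λ y)`, `λ² = ν(T - t)/σ`, is (with a pressure) a
  unit-viscosity local energy solution on `ℝ³ × (0, σ)` (restart at the regular time `t`,
  `IsGlobalLerayHopf.exists_isLocalEnergySolutionOn_restart`, and the covariance
  `IsLocalEnergySolutionOn.stRescale`) with datum in `L²(ℝ³)`, `‖v₀‖_{L²(B₁(x̄))} ≤ M` for every
  `x̄` (Type-I at radius `λ < r₀`), `‖v₀‖_{L³(B(0, 2√(σ/S)))} ≤ γ`, and `v` essentially unbounded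
  on every backward cylinder `Q_r(σ, 0)`, `0 < r`, `r² < σ`.
* `BarkerPrange2020_thm2_of_core` — **Theorem 2 from the compactness statement** `hcore`
  (written out inline; it is proved in the sequel files of this line): there is `γ > 0` such
  that for every `M > 0` there is `σ ∈ (0, 1)` for which no sequence of unit-viscosity local
  energy solutions on `ℝ³ × (0, σ)`, singular at `(σ, 0)`, with data in `L²(ℝ³)`,
  `‖v₀ⁿ‖_{L²(B₁(x̄))} ≤ M` and `‖v₀ⁿ‖_{L³(B(0, Rₙ))} ≤ γ`, `Rₙ → ∞`, exists. Proof: with that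
  `γ`, given `M` take `σ`; if no `S ∈ (0, ¼]` had the property of Theorem 2 (with
  `t_* = max(0, T - S r₀²/ν)`, `= 0` for `r₀ = ∞`, as in §4.2), then for
  `S_n = min(¼, σ/(n+1))` there would be violators, whose rescalings (first theorem) form a
  forbidden sequence with `R_n = 2√(σ/S_n) ≥ 2√(n+1)`.

## Mathlib / tree search

Tree (reused): `BarkerPrange2020_thm2`, `IsGlobalLerayHopf.exists_isLocalEnergySolutionOn_restart`,
`IsLocalEnergySolutionOn.stRescale`, `eLpNorm_comp_add_smul_ball`,
`eLpNorm_top_uncurry_smul_stPull_preimage`, `memLp_comp_add_smul`, `ofReal_inv_cube_rpow_half`,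
`ofReal_inv_cube_rpow_third`, `stAffine_preimage_cylinder`, `parabolicCylinder`,
`smul_stPull_apply` (`lean search 'BarkerPrange|compactness.*TypeI|concentration.*limit'`: no
compactness form of Theorem 2 in the tree). Mathlib: `tendsto_atTop_mono`,
`Real.tendsto_sqrt_atTop`, `tendsto_natCast_atTop_atTop`, `Real.sqrt_mul`, `Real.sqrt_le_sqrt`,
`ENNReal.mul_top`.

## References

* T. Barker, C. Prange, Arch. Ration. Mech. Anal. 236 (2020) 1487–1541 = arXiv:1812.09115:
  Thm. 2 (pp. 4–5), §4.2 (p. 16). [BarkerPrange2020]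
* G. Seregin, *Lecture Notes on Regularity Theory for the Navier–Stokes Equations* (2014),
  Ch. 7 §7.3, App. B §B.4 (the limiting procedure). [Seregin2014]
* P. G. Lemarié-Rieusset, *The Navier–Stokes Problem in the 21st Century* (2016), proof of
  Thm. 15.5, pp. 570–573 (stability of singular points). [LemarieRieusset2016]
-/

noncomputable section

open MeasureTheory Set Function Filter Metric Topology
open scoped ENNReal NNReal

namespace Literature.Analysis.FluidPDE

namespace BarkerPrange2020

/-- **One violator of Theorem 2, rescaled (Barker–Prange 2020, §4.2, arXiv:1812.09115 p. 16:
"`λ := √((T* - t₀)/S*(M))`, `u_λ(y, s) := λ u(λ y, t₀ + λ² s)`. Then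
`‖u_λ(·, 0)‖_{L³(|·| ≤ 2)} ≤ γ_univ`. Furthermore … we can take `r = λ ≤ r₀` and `t = t₀` in
(1.7). Therefore `‖u_λ(·, 0)‖_{L²_uloc} ≤ M`").** Here the rescaling is done with a strip length
`σ` in place of `S*(M)` (`λ² = ν(T - t)/σ`, so that the `L³`-ball becomes `B(0, 2√(σ/S))`), for
a general viscosity `ν` and blow-up point `x₀`: `v = (λ/ν) • stPull (λ²/ν) λ t x₀ u` is a
unit-viscosity local energy solution on `(0, σ)` (the restart of `u` at the regular time `t`,
rescaled), its datum `v₀ = (λ/ν) u(t, x₀ + λ ·)` lies in `L²(ℝ³)`, satisfies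
`‖v₀‖_{L²(B₁(x̄))} ≤ M` (Type-I at radius `λ`; `λ < r₀` because `T - S r₀²/ν < t` and `S ≤ σ`;
the time window `T - λ²/ν < t` because `σ < 1`) and `‖v₀‖_{L³(B(0, 2√(σ/S)))} ≤ γ`, and `v` is
essentially unbounded on every `Q_r(σ, 0)`, `0 < r`, `r² < σ` (such a cylinder contains the
preimage of `Q_ρ(T, x₀)`, `ρ = min(λ r/√(max 1 ν), √(T/2))`).
[cite: BarkerPrange2020, §4.2 (arXiv:1812.09115 p. 16)] -/
theorem exists_rescaled_of_small_L3 {ν T σ S M γ : ℝ} (hν : 0 < ν) (hT : 0 < T) (hσ : 0 < σ)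
    (hσ1 : σ < 1) (hS : 0 < S) (hSσ : S ≤ σ) {r₀ : ℝ≥0∞} (hr₀ : 0 < r₀)
    {u₀ : EuclideanSpace ℝ (Fin 3) → EuclideanSpace ℝ (Fin 3)}
    {u : ℝ → EuclideanSpace ℝ (Fin 3) → EuclideanSpace ℝ (Fin 3)}
    (hLH : IsGlobalLerayHopf ν 0 u₀ u)
    (hTypeI : ∀ (y : EuclideanSpace ℝ (Fin 3)) (r : ℝ), 0 < r → ENNReal.ofReal r < r₀ →
      ∀ t : ℝ, 0 < t → T - r ^ 2 / ν < t → t < T →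
        eLpNorm (u t) 2 (volume.restrict (ball y r)) ≤ ENNReal.ofReal (M * ν * Real.sqrt r))
    (hReg : ∀ t ∈ Ioo 0 T, ∀ x : EuclideanSpace ℝ (Fin 3), IsRegularPoint u (t, x))
    {x₀ : EuclideanSpace ℝ (Fin 3)}
    (hSing : ∀ r : ℝ, 0 < r → r ^ 2 < T →
      eLpNorm (uncurry u) ∞ (volume.restrict (parabolicCylinder r ((T : ℝ), x₀))) = ∞)
    {t : ℝ} (ht0 : 0 < t) (htT : t < T) (htS : r₀ ≠ ∞ → T - S * r₀.toReal ^ 2 / ν < t)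
    (hsmall : eLpNorm (u t) 3
      (volume.restrict (closedBall x₀ (2 * Real.sqrt (ν * (T - t) / S)))) ≤ ENNReal.ofReal (γ * ν)) :
    ∃ (v₀ : EuclideanSpace ℝ (Fin 3) → EuclideanSpace ℝ (Fin 3))
      (v : ℝ → EuclideanSpace ℝ (Fin 3) → EuclideanSpace ℝ (Fin 3))
      (π : ℝ → EuclideanSpace ℝ (Fin 3) → ℝ),
      IsLocalEnergySolutionOn σ 1 v₀ v π ∧ MemLp v₀ 2 volume ∧
      (∀ x₁ : EuclideanSpace ℝ (Fin 3),
        eLpNorm v₀ 2 (volume.restrict (ball x₁ 1)) ≤ ENNReal.ofReal M) ∧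
      eLpNorm v₀ 3 (volume.restrict (ball (0 : EuclideanSpace ℝ (Fin 3)) (2 * Real.sqrt (σ / S)))) ≤
        ENNReal.ofReal γ ∧
      ∀ r : ℝ, 0 < r → r ^ 2 < σ →
        eLpNorm (uncurry v) ∞
          (volume.restrict (parabolicCylinder r ((σ : ℝ), (0 : EuclideanSpace ℝ (Fin 3))))) = ∞ := by
  have hTt : 0 < T - t := sub_pos.2 htT
  -- the similarity scale `λ`, `λ² = ν (T - t) / σ`
  have hpos : 0 < ν * (T - t) / σ := div_pos (mul_pos hν hTt) hσ
  obtain ⟨l, hl_def, hl, hl2⟩ :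
      ∃ l : ℝ, l = Real.sqrt (ν * (T - t) / σ) ∧ 0 < l ∧ l ^ 2 = ν * (T - t) / σ :=
    ⟨_, rfl, Real.sqrt_pos.2 hpos, Real.sq_sqrt hpos.le⟩
  have hν0 : ν ≠ 0 := hν.ne'
  have hσ0 : σ ≠ 0 := hσ.ne'
  have hS0 : S ≠ 0 := hS.ne'
  have hl0 : l ≠ 0 := hl.ne'
  have hTt0 : T - t ≠ 0 := hTt.ne'
  have hβ : 0 < l ^ 2 / ν := by positivity
  have hl2ν : l ^ 2 / ν = (T - t) / σ := by
    rw [hl2]; field_simp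
  -- `λ < r₀` (the hypothesis `T - S r₀²/ν < t` and `S ≤ σ`)
  have hlr₀ : ENNReal.ofReal l < r₀ := by
    by_cases hinf : r₀ = ∞
    · rw [hinf]; exact ENNReal.ofReal_lt_top
    · have hr : 0 < r₀.toReal := ENNReal.toReal_pos hr₀.ne' hinf
      have h1 : T - t < S * r₀.toReal ^ 2 / ν := by linarith [htS hinf]
      have h1' : ν * (T - t) < S * r₀.toReal ^ 2 := by
        rw [lt_div_iff₀ hν] at h1; linarith
      have h2 : ν * (T - t) / σ < r₀.toReal ^ 2 := by
        rw [div_lt_iff₀ hσ]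
        have : S * r₀.toReal ^ 2 ≤ σ * r₀.toReal ^ 2 := by gcongr
        nlinarith
      have h3 : l < r₀.toReal := by
        rw [← Real.sqrt_sq hr.le, hl_def]
        exact Real.sqrt_lt_sqrt hpos.le h2
      calc ENNReal.ofReal l < ENNReal.ofReal r₀.toReal := (ENNReal.ofReal_lt_ofReal_iff hr).2 h3
        _ = r₀ := ENNReal.ofReal_toReal hinf
  -- the time window of the Type-I bound at radius `λ`: `T - λ²/ν < t` since `σ < 1`
  have hwin : T - l ^ 2 / ν < t := by
    rw [hl2ν]
    have h1 : (T - t) * σ < T - t := mul_lt_of_lt_one_right hTt hσ1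
    have h2 : T - t < (T - t) / σ := (lt_div_iff₀ hσ).2 h1
    linarith
  -- the restarted solution, and the rescaled local energy solution of §4.2
  obtain ⟨π, hπ⟩ := hLH.exists_isLocalEnergySolutionOn_restart hν hT hReg ⟨ht0, htT⟩
  have hβeq : l ^ 2 / ν = l / ν * l := by
    rw [sq]; ring
  have hv := hπ.stRescale (div_pos hl hν) hl hβeq x₀
  have hslab : (T - t) / (l ^ 2 / ν) = σ := by
    rw [hl2]; field_simp
  have hvisc : l / ν * ν / l = 1 := by
    field_simp
  have hfun : ((l / ν) • stPull (l ^ 2 / ν) l 0 x₀ fun s => u (t + s)) =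
      (l / ν) • stPull (l ^ 2 / ν) l t x₀ u := by
    funext s y
    simp only [smul_stPull_apply, zero_add]
  rw [hslab, hvisc, hfun] at hv
  -- its datum: in `L²`
  have hut : MemLp (u t) 2 volume := (hLH T hT).memLp t ⟨ht0.le, htT.le⟩
  have hv₀2 : MemLp (fun y => (l / ν) • u t (x₀ + l • y)) 2 volume :=
    (memLp_comp_add_smul hut x₀ hl).const_smul (l / ν)
  have hsmul : ∀ q : ℝ≥0∞, ∀ μ : Measure (EuclideanSpace ℝ (Fin 3)),
      eLpNorm (fun y => (l / ν) • u t (x₀ + l • y)) q μ =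
        ‖l / ν‖ₑ * eLpNorm (fun y => u t (x₀ + l • y)) q μ := fun q μ => by
    rw [show (fun y => (l / ν) • u t (x₀ + l • y)) = (l / ν) • fun y => u t (x₀ + l • y)
      from rfl, eLpNorm_const_smul]
  have hlν : ‖l / ν‖ₑ = ENNReal.ofReal (l / ν) := Real.enorm_eq_ofReal (by positivity)
  -- `‖v₀‖_{L²(B₁(x̄))} ≤ M` from the Type-I bound at radius `λ`
  have hL2 : ∀ x₁ : EuclideanSpace ℝ (Fin 3), eLpNorm (fun y => (l / ν) • u t (x₀ + l • y)) 2
      (volume.restrict (ball x₁ 1)) ≤ ENNReal.ofReal M := by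
    intro x₁
    have hTI := hTypeI (x₀ + l • x₁) l hl hlr₀ t ht0 hwin htT
    have hsl : l * Real.sqrt l = Real.sqrt l ^ 3 := by
      calc l * Real.sqrt l = Real.sqrt l ^ 2 * Real.sqrt l := by rw [Real.sq_sqrt hl.le]
        _ = Real.sqrt l ^ 3 := by ring
    have hs0 : 0 < Real.sqrt l := Real.sqrt_pos.2 hl
    calc eLpNorm (fun y => (l / ν) • u t (x₀ + l • y)) 2 (volume.restrict (ball x₁ 1))
        = ‖l / ν‖ₑ * (ENNReal.ofReal ((l ^ 3)⁻¹) ^ (1 / (2 : ℝ≥0∞)).toReal *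
            eLpNorm (u t) 2 (volume.restrict (ball (x₀ + l • x₁) (l * 1)))) := by
          rw [hsmul, eLpNorm_comp_add_smul_ball (u t) x₀ x₁ hl 1 (by norm_num)]
      _ ≤ ‖l / ν‖ₑ * (ENNReal.ofReal ((Real.sqrt l ^ 3)⁻¹) *
            ENNReal.ofReal (M * ν * Real.sqrt l)) := by
          rw [ofReal_inv_cube_rpow_half hl, mul_one]
          gcongr
      _ = ENNReal.ofReal M := by
          rw [hlν, ← ENNReal.ofReal_mul (by positivity), ← ENNReal.ofReal_mul (by positivity)]
          congr 1
          rw [← hsl]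
          field_simp
  -- `‖v₀‖_{L³(B(0, 2√(σ/S)))} ≤ γ` from the assumed smallness at time `t`
  have hrad : l * (2 * Real.sqrt (σ / S)) = 2 * Real.sqrt (ν * (T - t) / S) := by
    have h1 : l * Real.sqrt (σ / S) = Real.sqrt (ν * (T - t) / S) := by
      rw [hl_def, ← Real.sqrt_mul hpos.le]
      congr 1
      field_simp
    calc l * (2 * Real.sqrt (σ / S)) = 2 * (l * Real.sqrt (σ / S)) := by ring
      _ = 2 * Real.sqrt (ν * (T - t) / S) := by rw [h1]
  have hL3 : eLpNorm (fun y => (l / ν) • u t (x₀ + l • y)) 3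
      (volume.restrict (ball (0 : EuclideanSpace ℝ (Fin 3)) (2 * Real.sqrt (σ / S)))) ≤
        ENNReal.ofReal γ := by
    have h1 : eLpNorm (u t) 3 (volume.restrict (ball x₀ (2 * Real.sqrt (ν * (T - t) / S)))) ≤
        ENNReal.ofReal (γ * ν) :=
      (eLpNorm_mono_measure _ (Measure.restrict_mono ball_subset_closedBall le_rfl)).trans hsmall
    calc eLpNorm (fun y => (l / ν) • u t (x₀ + l • y)) 3
          (volume.restrict (ball (0 : EuclideanSpace ℝ (Fin 3)) (2 * Real.sqrt (σ / S))))
        = ‖l / ν‖ₑ * (ENNReal.ofReal ((l ^ 3)⁻¹) ^ (1 / (3 : ℝ≥0∞)).toReal *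
            eLpNorm (u t) 3 (volume.restrict
              (ball (x₀ + l • (0 : EuclideanSpace ℝ (Fin 3))) (l * (2 * Real.sqrt (σ / S)))))) := by
          rw [hsmul, eLpNorm_comp_add_smul_ball (u t) x₀ 0 hl (2 * Real.sqrt (σ / S)) (by norm_num)]
      _ ≤ ‖l / ν‖ₑ * (ENNReal.ofReal l⁻¹ * ENNReal.ofReal (γ * ν)) := by
          rw [ofReal_inv_cube_rpow_third hl, smul_zero, add_zero, hrad]
          gcongr
      _ = ENNReal.ofReal γ := by
          rw [hlν, ← ENNReal.ofReal_mul (by positivity), ← ENNReal.ofReal_mul (by positivity)]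
          congr 1
          field_simp
  refine ⟨_, _, _, hv, hv₀2, hL2, hL3, ?_⟩
  -- singularity of `(σ, 0)` for the rescaled field
  intro r hr hrσ
  set m : ℝ := Real.sqrt (max 1 ν) with hm_def
  have hm1 : 1 ≤ m := by
    rw [hm_def]
    calc (1 : ℝ) = Real.sqrt 1 := Real.sqrt_one.symm
      _ ≤ Real.sqrt (max 1 ν) := Real.sqrt_le_sqrt (le_max_left 1 ν)
  have hm0 : 0 < m := lt_of_lt_of_le one_pos hm1
  have hm2 : m ^ 2 = max 1 ν := Real.sq_sqrt (le_trans zero_le_one (le_max_left _ _))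
  set ρ : ℝ := min (l * r / m) (Real.sqrt (T / 2)) with hρ_def
  have hρ : 0 < ρ := lt_min (by positivity) (Real.sqrt_pos.2 (by positivity))
  have hρ1 : ρ ≤ l * r / m := min_le_left _ _
  have hρT : ρ ^ 2 < T := by
    have h1 : ρ ≤ Real.sqrt (T / 2) := min_le_right _ _
    have h2 : ρ ^ 2 ≤ Real.sqrt (T / 2) ^ 2 := pow_le_pow_left₀ hρ.le h1 2
    rw [Real.sq_sqrt (by positivity)] at h2
    linarith
  -- the preimage of `Q_ρ(T, x₀)` lies inside `Q_r(σ, 0)`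
  have hpre : stAffine (l ^ 2 / ν) l t x₀ ⁻¹' parabolicCylinder ρ ((T : ℝ), x₀) =
      Ioo (σ - ρ ^ 2 / (l ^ 2 / ν)) σ ×ˢ ball (0 : EuclideanSpace ℝ (Fin 3)) (ρ / l) := by
    rw [parabolicCylinder, stAffine_preimage_cylinder hβ hl, sub_self, smul_zero]
    show Ioo ((T - ρ ^ 2 - t) / (l ^ 2 / ν)) ((T - t) / (l ^ 2 / ν)) ×ˢ
        ball (0 : EuclideanSpace ℝ (Fin 3)) (ρ / l) = _
    have e1 : (T - ρ ^ 2 - t) / (l ^ 2 / ν) = σ - ρ ^ 2 / (l ^ 2 / ν) := by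
      rw [← hslab]; field_simp; ring
    rw [e1, hslab]
  have hsub : Ioo (σ - ρ ^ 2 / (l ^ 2 / ν)) σ ×ˢ ball (0 : EuclideanSpace ℝ (Fin 3)) (ρ / l) ⊆
      parabolicCylinder r ((σ : ℝ), (0 : EuclideanSpace ℝ (Fin 3))) := by
    have hρl : ρ / l ≤ r := by
      rw [div_le_iff₀ hl]
      calc ρ ≤ l * r / m := hρ1
        _ ≤ l * r / 1 := by gcongr
        _ = r * l := by ring
    have hρβ : ρ ^ 2 / (l ^ 2 / ν) ≤ r ^ 2 := by
      rw [div_le_iff₀ hβ]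
      have h1 : ρ ^ 2 ≤ (l * r / m) ^ 2 := pow_le_pow_left₀ hρ.le hρ1 2
      have h2 : (l * r / m) ^ 2 = l ^ 2 * r ^ 2 / max 1 ν := by
        rw [div_pow, mul_pow, hm2]
      have h3 : l ^ 2 * r ^ 2 / max 1 ν ≤ l ^ 2 * r ^ 2 / ν :=
        div_le_div_of_nonneg_left (by positivity) hν (le_max_right _ _)
      calc ρ ^ 2 ≤ l ^ 2 * r ^ 2 / ν := h1.trans (h2.le.trans h3)
        _ = r ^ 2 * (l ^ 2 / ν) := by ring
    rintro ⟨s, y⟩ ⟨hs, hy⟩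
    rw [mem_parabolicCylinder]
    refine ⟨⟨?_, hs.2⟩, ?_⟩
    · have := hs.1
      dsimp only
      linarith
    · rw [mem_ball] at hy
      exact lt_of_lt_of_le hy hρl
  have hinf : eLpNorm (uncurry ((l / ν) • stPull (l ^ 2 / ν) l t x₀ u)) ∞
      (volume.restrict (stAffine (l ^ 2 / ν) l t x₀ ⁻¹' parabolicCylinder ρ ((T : ℝ), x₀))) = ∞ := by
    rw [eLpNorm_top_uncurry_smul_stPull_preimage hβ hl, hSing ρ hρ hρT, hlν,
      ENNReal.mul_top (ENNReal.ofReal_pos.2 (by positivity)).ne']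
  refine eq_top_iff.2 ?_
  calc (⊤ : ℝ≥0∞) = eLpNorm (uncurry ((l / ν) • stPull (l ^ 2 / ν) l t x₀ u)) ∞
        (volume.restrict (stAffine (l ^ 2 / ν) l t x₀ ⁻¹' parabolicCylinder ρ ((T : ℝ), x₀))) :=
        hinf.symm
    _ ≤ eLpNorm (uncurry ((l / ν) • stPull (l ^ 2 / ν) l t x₀ u)) ∞
        (volume.restrict (parabolicCylinder r ((σ : ℝ), (0 : EuclideanSpace ℝ (Fin 3))))) := by
        rw [hpre]
        exact eLpNorm_mono_measure _ (Measure.restrict_mono hsub le_rfl)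

end BarkerPrange2020

/-! ### Theorem 2 from the compactness statement -/

/-- **Barker–Prange 2020, Theorem 2 from the compactness statement.** `hcore` (proved in the
sequel files of this line; written out inline so that no named fact is introduced): there is
`γ > 0` such that for every `M > 0` there is `σ ∈ (0, 1)` for which there is NO sequence
`(v₀ⁿ, vⁿ, πⁿ)` of unit-viscosity local energy solutions on `ℝ³ × (0, σ)`
(`IsLocalEnergySolutionOn σ 1`), with data in `L²(ℝ³)`, `‖v₀ⁿ‖_{L²(B₁(x̄))} ≤ M` for all `x̄`,
`‖v₀ⁿ‖_{L³(B(0, Rₙ))} ≤ γ` with `Rₙ → ∞`, all essentially unbounded on every backward cylinder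
`Q_r(σ, 0)`, `0 < r`, `r² < σ`. Then `BarkerPrange2020_thm2` holds, with that `γ`: given `M`,
some `S ∈ (0, ¼]` has the property of Theorem 2 with `t_* = max(0, T - S r₀²/ν)` (`= 0` for
`r₀ = ∞`) — otherwise the violators for `Sₙ = min(¼, σ/(n+1))`, rescaled by
`BarkerPrange2020.exists_rescaled_of_small_L3`, would form such a sequence with
`Rₙ = 2√(σ/Sₙ) ≥ 2√(n+1)`. (A compactness proof of the printed statement; the printed proof,
via the paper's Theorem 1, is `BarkerPrange2020_thm2_of_thm1`.)
[cite: BarkerPrange2020, Thm. 2 (arXiv:1812.09115 pp. 4–5) and §4.2 (p. 16)] -/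
theorem BarkerPrange2020_thm2_of_core
    (hcore : ∃ γ : ℝ, 0 < γ ∧ ∀ M : ℝ, 0 < M → ∃ σ : ℝ, 0 < σ ∧ σ < 1 ∧
      ∀ (R : ℕ → ℝ) (v₀ : ℕ → EuclideanSpace ℝ (Fin 3) → EuclideanSpace ℝ (Fin 3))
        (v : ℕ → ℝ → EuclideanSpace ℝ (Fin 3) → EuclideanSpace ℝ (Fin 3))
        (π : ℕ → ℝ → EuclideanSpace ℝ (Fin 3) → ℝ),
        Tendsto R atTop atTop →
        (∀ n, IsLocalEnergySolutionOn σ 1 (v₀ n) (v n) (π n)) →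
        (∀ n, MemLp (v₀ n) 2 volume) →
        (∀ n, ∀ x₁ : EuclideanSpace ℝ (Fin 3),
          eLpNorm (v₀ n) 2 (volume.restrict (ball x₁ 1)) ≤ ENNReal.ofReal M) →
        (∀ n, eLpNorm (v₀ n) 3 (volume.restrict (ball (0 : EuclideanSpace ℝ (Fin 3)) (R n))) ≤
          ENNReal.ofReal γ) →
        (∀ n, ∀ r : ℝ, 0 < r → r ^ 2 < σ →
          eLpNorm (uncurry (v n)) ∞
            (volume.restrict (parabolicCylinder r ((σ : ℝ), (0 : EuclideanSpace ℝ (Fin 3))))) = ∞) →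
        False) :
    BarkerPrange2020_thm2 := by
  obtain ⟨γ, hγ, hcore⟩ := hcore
  refine ⟨γ, hγ, fun M hM => ?_⟩
  obtain ⟨σ, hσ, hσ1, hcoreM⟩ := hcore M hM
  by_contra H
  -- the sequence of strip lengths `Sₙ = min(¼, σ/(n+1)) → 0`
  set S : ℕ → ℝ := fun n => min (1 / 4) (σ / (n + 1)) with hS_def
  have hSpos : ∀ n, 0 < S n := fun n => lt_min (by norm_num) (by positivity)
  have hS4 : ∀ n, S n ≤ 1 / 4 := fun n => min_le_left _ _
  have hSσ' : ∀ n, S n ≤ σ / (n + 1) := fun n => min_le_right _ _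
  have hSσ : ∀ n, S n ≤ σ := fun n => (hSσ' n).trans
    (div_le_self hσ.le (by exact_mod_cast Nat.succ_le_succ (Nat.zero_le n)))
  -- for every `n` there is a rescaled violator
  have key : ∀ n : ℕ, ∃ (v₀ : EuclideanSpace ℝ (Fin 3) → EuclideanSpace ℝ (Fin 3))
      (v : ℝ → EuclideanSpace ℝ (Fin 3) → EuclideanSpace ℝ (Fin 3))
      (π : ℝ → EuclideanSpace ℝ (Fin 3) → ℝ),
      IsLocalEnergySolutionOn σ 1 v₀ v π ∧ MemLp v₀ 2 volume ∧
      (∀ x₁ : EuclideanSpace ℝ (Fin 3),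
        eLpNorm v₀ 2 (volume.restrict (ball x₁ 1)) ≤ ENNReal.ofReal M) ∧
      eLpNorm v₀ 3 (volume.restrict (ball (0 : EuclideanSpace ℝ (Fin 3))
        (2 * Real.sqrt (σ / S n)))) ≤ ENNReal.ofReal γ ∧
      ∀ r : ℝ, 0 < r → r ^ 2 < σ →
        eLpNorm (uncurry v) ∞
          (volume.restrict (parabolicCylinder r ((σ : ℝ), (0 : EuclideanSpace ℝ (Fin 3))))) = ∞ := by
    intro n
    by_contra hn
    push Not at hn
    apply H
    refine ⟨S n, hSpos n, hS4 n, fun ν T hν hT r₀ hr₀ => ?_⟩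
    -- the time `t_*` of §4.2
    set tStar : ℝ := if r₀ = ∞ then 0 else max 0 (T - S n * r₀.toReal ^ 2 / ν) with htStar_def
    have htStar0 : 0 ≤ tStar := by
      rw [htStar_def]
      split_ifs
      · exact le_rfl
      · exact le_max_left _ _
    have htStarT : tStar < T := by
      rw [htStar_def]
      split_ifs with h
      · exact hT
      · have hr : 0 < r₀.toReal := ENNReal.toReal_pos hr₀.ne' h
        have : 0 < S n * r₀.toReal ^ 2 / ν := by
          have := hSpos n
          positivity
        exact max_lt hT (by linarith)
    refine ⟨tStar, htStar0, htStarT, fun h => by rw [htStar_def, if_pos h], ?_⟩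
    intro u₀ u hLH hTypeI hReg x₀ hSing t ht
    have ht0 : 0 < t := lt_of_le_of_lt htStar0 ht.1
    by_contra hcon
    rw [not_lt] at hcon
    have htS : r₀ ≠ ∞ → T - S n * r₀.toReal ^ 2 / ν < t := by
      intro hinf
      have htS' : T - S n * r₀.toReal ^ 2 / ν ≤ tStar := by
        rw [htStar_def, if_neg hinf]; exact le_max_right _ _
      exact lt_of_le_of_lt htS' ht.1
    obtain ⟨v₀, v, π, hv, hv2, hvM, hvL3, hvsing⟩ :=
      BarkerPrange2020.exists_rescaled_of_small_L3 hν hT hσ hσ1 (hSpos n) (hSσ n) hr₀ hLH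
        hTypeI hReg hSing ht0 ht.2 htS hcon
    obtain ⟨r, hr, hrσ, hne⟩ := hn v₀ v π hv hv2 hvM hvL3
    exact hne (hvsing r hr hrσ)
  choose v₀ v π hv hv2 hvM hvL3 hvsing using key
  refine hcoreM (fun n => 2 * Real.sqrt (σ / S n)) v₀ v π ?_ hv hv2 hvM hvL3 hvsing
  -- `Rₙ = 2√(σ/Sₙ) ≥ √(n+1) → ∞`
  have hlow : ∀ n : ℕ, Real.sqrt ((n : ℝ) + 1) ≤ 2 * Real.sqrt (σ / S n) := by
    intro n
    have h1 : ((n : ℝ) + 1) ≤ σ / S n := by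
      rw [le_div_iff₀ (hSpos n)]
      calc ((n : ℝ) + 1) * S n ≤ ((n : ℝ) + 1) * (σ / (n + 1)) := by gcongr; exact hSσ' n
        _ = σ := by field_simp
    have h2 : Real.sqrt ((n : ℝ) + 1) ≤ Real.sqrt (σ / S n) := Real.sqrt_le_sqrt h1
    exact h2.trans (le_mul_of_one_le_left (Real.sqrt_nonneg _) one_le_two)
  refine tendsto_atTop_mono hlow ?_
  exact Real.tendsto_sqrt_atTop.comp
    (tendsto_atTop_add_const_right atTop 1 tendsto_natCast_atTop_atTop)

end Literature.Analysis.FluidPDE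

end
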